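import Literature.GroupTheory.SpecificGroups.PadicAffineGroup
import Literature.AnabelianGeometry.SemiGraphs.ArithMaximalCompactTrivialBase
import Literature.AnabelianGeometry.SemiGraphs.ArithVerticialCompactAmple
import Mathlib.Tactic.LinearCombination
import Mathlib.Tactic.Group
import HarnessLib

/-!
# [SemiAnbd] Def 5.3 (ii) p. 65 — a NON-SPLIT design WITH AN EDGE at which «totally arithmetically estranged»
# HOLDS: the affine witness `pℤ_p ⋊ ℤ_pˣ ⊂ Aff(ℤ_p)` («two cusps of the ax+b group»; proof-only NV certificate)

Mochizuki, *Semi-graphs of anabelioids*, Publ. RIMS **42** (2006), §5: Def. 5.3 (i)/(ii)/(iii) p. 65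
(arithmetically ample; arithmetically estranged edges, totally arithmetically estranged; verticial / edge-like),
Rmk. 5.3.1 p. 65 («all verticial and edge-like subgroups of `Π^temp_𝔊` are compact and arithmetically ample»),
Thm. 5.4 p. 66, Ex. 5.6 p. 67 l. 51–53 («it follows immediately from Lemma 5.5 that `𝔊_i`, `𝔊_i^c` are totally
arithmetically estranged») [cite: MochizukiSemiAnbd2006, Def 5.3 (ii), p. 65].

PROOF-ONLY file (cell abc-iut, layer L3, T54 binder board, row «NV-hest-NONSPLIT» = abc-iut-L3-lead α76/α85;
design memo of abc-iut-w6-d072 `HOME/staging/w6/w6-d072/NV-hest-NONSPLIT-affine-design.md`, formalised by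
abc-iut-w6-d064 over abc-iut-w5-d212's `PadicAffine p = Aff(ℤ_p) = ℤ_p ⋊ ℤ_pˣ`).  State of the row before this
file: the capstone's design input `hest : IsTotallyArithEstranged …` (Thm. 5.4's hypothesis «totally
arithmetically estranged») is
* VACUOUSLY inhabited at EDGELESS models (abc-iut-w6-d099, `ArithThm54DesignInputsNonVacuity`),
* FALSE at every SPLIT model with a node (`ρ' = 1`: abc-iut-w6-d072, `not_isTotallyArithEstranged_of_trivial`),
* FALSE whenever the kernel of the arithmetic action is OPEN (abc-iut-w4-d040,
  `ArithTotalEstrangementOpenKernelObstruction`).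

THIS FILE gives the complementary POSITIVE certificate at the level at which Def. 5.3 is typed
(`ArithMaximalCompact.lean`: abstract `DecompositionData Gtp V B` + augmentation `aug : Gtp →* PA`): an explicit
decomposition datum on the LOOP semi-graph (ONE vertex, ONE EDGE with two DISTINCT branches, both abutting to the
vertex) inside the compact topological group `Gtp := Aff(ℤ_p)` of substitutions `x ↦ u x + a`, with
`Π_A := ℤ_pˣ` and `aug := (x ↦ u x + a) ↦ u` (the linear part; continuous and surjective):

* vertex group `Π_v := pℤ_p ⋊ ℤ_pˣ = {x ↦ u x + a : a ∈ pℤ_p}`;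
* branch groups `Π_{b₀} := Stab(0) = {x ↦ u x}` and `Π_{b₁} := Stab(1) ∩ Π_v = {x ↦ u x + (1 - u) : u ∈ 1 + pℤ_p}`

— the arithmetic analogue of «the decomposition groups of two distinct cusps `0`, `1` of the `ax + b` group»,
the restriction `a ∈ pℤ_p` putting `0` and `1` into DIFFERENT `Π_v`-orbits (`pℤ_p` and `ℤ_pˣ`).  The theorem
`exists_isTotallyArithEstranged_affine` packages: (1) Rmk. 5.3.1's first sentence IN FULL — every verticial and
every edge-like subgroup (all conjugates) is compact and arithmetically ample (images `ℤ_pˣ`, `ℤ_pˣ`, `1 + pℤ_p`);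
(2) NON-SPLIT in the strongest sense: `Π_A` acts FAITHFULLY (by conjugation through any lift) on the non-trivial
geometric vertex group `Π_{𝔾,v} = Π_v ∩ Ker(aug) = pℤ_p` — it acts by MULTIPLICATION — so the kernel of the
action is `⊥`, which is NOT open in `ℤ_pˣ` (abc-iut-w4-d040's necessary condition is met, not dodged);
(3) Thm. 5.4's second hypothesis `hbot : ¬ IsArithAmple aug ⊥`, DERIVED from (4) by abc-iut's
`IsTotallyArithEstranged.not_isArithAmple_bot`; (4) `IsTotallyArithEstranged D aug`.
Heart of (4): an affine substitution over the DOMAIN `ℤ_p` fixing two distinct points is the identity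
(`affine_eq_one_of_fix_two`), and `g · Stab(c) · g⁻¹ ⊆ Stab(g · c)` (`affine_conj_fix`); since `g · 1 ∈ ℤ_pˣ ∌ 0`
and `g · 0 ∈ pℤ_p ∌ 1` for `g ∈ Π_v`, every intersection occurring in Def. 5.3 (ii) is TRIVIAL, with image
`{1} ⊂ ℤ_pˣ`, which is not open (`not_isOpen_singleton_one_units_padicInt`).

HONEST SCOPE: an ABSTRACT-`D` witness (Def. 5.3 (ii) is contentful and jointly satisfiable with «edge present»,
Rmk. 5.3.1's compact-and-ample clause, «`Π_A` acts faithfully», `hbot`); it is NOT yet a tempered-chart design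
(`decompositionDataOfChart` of a `TemperedPiChart` of the loop / cusp graph whose branch groups are these
stabilisers — the `𝔾_m`/Tate picture), which is the follow-up row.  No definition, no instance, no new named
fact; nothing here asserts or denies a hypothesis of Thm. 5.4 for any genuine datum of [SemiAnbd] Ex. 5.6;
nothing here bears on [IUTchIII] Cor. 3.12; witnessed ≠ endorsed; typed ≠ proved.
-/

noncomputable section

namespace Literature.AnabelianGeometry.SemiGraphs

open Topology
open Literature.GroupTheory.SpecificGroups

universe u

variable {p : ℕ} [Fact p.Prime]

/-! ### The affine calculus on `Aff(ℤ_p)`: `g = (a, u)` acts on `c ∈ ℤ_p` by `g · c := u c + a` -/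

/-- Composition law of the affine action `g · c = u_g c + a_g`: `(g h) · c = g · (h · c)`.
[cite: MochizukiSemiAnbd2006, Def 5.3 (ii), p. 65] -/
theorem affine_act_mul (g h : PadicAffine p) (c : ℤ_[p]) :
    ((g * h).u : ℤ_[p]) * c + (g * h).a = (g.u : ℤ_[p]) * ((h.u : ℤ_[p]) * c + h.a) + g.a := by
  rw [PadicAffine.mul_u, PadicAffine.mul_a, Units.val_mul]
  ring

/-- `g · Stab(c) · g⁻¹ ⊆ Stab(g · c)`: if `k` fixes `c` then `g k g⁻¹` fixes `g · c`.
[cite: MochizukiSemiAnbd2006, Def 5.3 (ii), p. 65] -/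
theorem affine_conj_fix (g k : PadicAffine p) {c : ℤ_[p]} (hk : (k.u : ℤ_[p]) * c + k.a = c) :
    ((g * k * g⁻¹).u : ℤ_[p]) * ((g.u : ℤ_[p]) * c + g.a) + (g * k * g⁻¹).a = (g.u : ℤ_[p]) * c + g.a := by
  have e1 := affine_act_mul (g * k * g⁻¹) g c
  have e2 := affine_act_mul g k c
  rw [hk] at e2
  have e3 : g * k * g⁻¹ * g = g * k := by group
  rw [e3] at e1
  exact e1.symm.trans e2

/-- **Two fixed points force the identity**: a substitution `x ↦ u x + a` of the DOMAIN `ℤ_p` fixing two distinct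
points is trivial (`u c + a = c`, `u c' + a = c'` ⇒ `(u - 1)(c - c') = 0` ⇒ `u = 1`, `a = 0`).
[cite: MochizukiSemiAnbd2006, Def 5.3 (ii), p. 65] -/
theorem affine_eq_one_of_fix_two {g : PadicAffine p} {c c' : ℤ_[p]} (hc : (g.u : ℤ_[p]) * c + g.a = c)
    (hc' : (g.u : ℤ_[p]) * c' + g.a = c') (hne : c ≠ c') : g = 1 := by
  have hu : ((g.u : ℤ_[p]) - 1) * (c - c') = 0 := by linear_combination hc - hc'
  have hu' : (g.u : ℤ_[p]) = 1 := by
    rcases mul_eq_zero.mp hu with h | h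
    · exact sub_eq_zero.mp h
    · exact absurd (sub_eq_zero.mp h) hne
  have ha : g.a = 0 := by
    rw [hu', one_mul] at hc
    linear_combination hc
  exact PadicAffine.ext (by rw [ha, PadicAffine.one_a]) (Units.ext (by rw [hu', PadicAffine.one_u, Units.val_one]))

/-! ### `ℤ_pˣ` has no isolated point: `{1}` (hence `⊥`) is not open -/

/-- `{1} ⊆ ℤ_pˣ` is NOT open: `1 + p^k → 1` in `ℤ_p`, `p^k ≠ 0`, and `Units.val : ℤ_pˣ → ℤ_p` is an open embedding
(complete normed ring). [cite: MochizukiSemiAnbd2006, Def 5.3 (i), p. 65] -/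
theorem not_isOpen_singleton_one_units_padicInt (p : ℕ) [Fact p.Prime] :
    ¬ IsOpen ({1} : Set ℤ_[p]ˣ) := by
  intro h
  have h' : IsOpen ({(1 : ℤ_[p])} : Set ℤ_[p]) := by
    have himg := Units.isOpenEmbedding_val.isOpenMap _ h
    rwa [Set.image_singleton, Units.val_one] at himg
  rw [Metric.isOpen_singleton_iff] at h'
  obtain ⟨ε, hε, hball⟩ := h'
  obtain ⟨k, hk⟩ := PadicInt.exists_pow_neg_lt p hε
  have hmem : dist ((1 : ℤ_[p]) + (p : ℤ_[p]) ^ k) 1 < ε := by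
    rw [dist_eq_norm, add_sub_cancel_left, PadicInt.norm_p_pow]
    exact hk
  have h1 := hball _ hmem
  have hpk : (p : ℤ_[p]) ^ k = 0 := by linear_combination h1
  exact PadicAffine.pow_p_ne_zero k hpk

/-- Hence the trivial subgroup of `Π_A = ℤ_pˣ` is not open («`Π_A` is not discrete»; abc-iut-w4-d040's necessary
condition `¬ IsOpen (Ker ρ)` for `hest`, here with `Ker ρ = ⊥`). [cite: MochizukiSemiAnbd2006, Def 5.3 (i), p. 65] -/
theorem not_isOpen_bot_units_padicInt (p : ℕ) [Fact p.Prime] :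
    ¬ IsOpen ((⊥ : Subgroup ℤ_[p]ˣ) : Set ℤ_[p]ˣ) := by
  rw [Subgroup.coe_bot]
  exact not_isOpen_singleton_one_units_padicInt p

/-- A subgroup all of whose elements are trivial is NOT arithmetically ample for an augmentation to `ℤ_pˣ`
(its image is `{1}`). [cite: MochizukiSemiAnbd2006, Def 5.3 (i), p. 65] -/
theorem not_isArithAmple_of_forall_eq_one {Gtp : Type u} [Group Gtp] (aug : Gtp →* ℤ_[p]ˣ)
    {K : Subgroup Gtp} (hK : ∀ h ∈ K, h = 1) : ¬ IsArithAmple aug K := by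
  have hbot : K = ⊥ := (Subgroup.eq_bot_iff_forall K).mpr hK
  unfold IsArithAmple
  rw [hbot, Subgroup.map_bot]
  exact not_isOpen_bot_units_padicInt p

/-! ### The affine witness -/

/-- **[SemiAnbd] Def. 5.3 (ii) is CONTENTFUL at a NON-SPLIT model WITH AN EDGE — the affine witness in `Aff(ℤ_p)`.**
There are an augmentation `aug : Aff(ℤ_p) →* ℤ_pˣ =: Π_A` — the linear part `(x ↦ u x + a) ↦ u`, continuous and
surjective — and a decomposition datum `D` in `Gtp := Aff(ℤ_p)` over the LOOP semi-graph (vertex type `Unit`,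
branch type `Bool`: ONE edge, its two branches distinct and both abutting to the vertex) such that:
Rmk. 5.3.1 (first sentence) holds in full — every verticial and every edge-like subgroup is compact and
arithmetically ample; `Π_A` acts FAITHFULLY on the non-trivial geometric vertex group `Π_v ∩ Ker(aug)` (an
element of `Π_v` centralising it has trivial image in `Π_A`: the model is NON-SPLIT, and the kernel `⊥` of the
action is not open in `Π_A`); Thm. 5.4's hypothesis `¬ IsArithAmple aug ⊥` holds; and `D` is TOTALLY
ARITHMETICALLY ESTRANGED.  (Vertex group `pℤ_p ⋊ ℤ_pˣ`, branch groups the stabilisers of the cusps `0` and `1`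
under `x ↦ u x + a`.)  Abstract-`D` level; witnessed ≠ endorsed. [cite: MochizukiSemiAnbd2006, Def 5.3 (ii), p. 65] -/
theorem exists_isTotallyArithEstranged_affine (p : ℕ) [Fact p.Prime] :
    ∃ (aug : PadicAffine p →* ℤ_[p]ˣ) (D : DecompositionData (PadicAffine p) Unit Bool),
      -- the augmentation is the linear part: continuous, surjective
      (∀ x, aug x = x.u) ∧ Continuous aug ∧ Function.Surjective aug ∧
      -- the semi-graph is the LOOP: one edge, both (distinct) branches abut to the vertex
      (∀ b b' : Bool, D.edgeOf b = D.edgeOf b') ∧ (∀ b : Bool, D.abut b = some ()) ∧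
      -- the decomposition groups: `Π_v = {a ∈ pℤ_p}`, `Π_{b₀} = Stab(0)`, `Π_{b₁} = Stab(1) ∩ Π_v`
      (∀ x, x ∈ D.vertGp () ↔ ‖x.a‖ < 1) ∧
      (∀ x, x ∈ D.brGp false ↔ x.a = 0) ∧
      (∀ x, x ∈ D.brGp true ↔ ‖x.a‖ < 1 ∧ (x.u : ℤ_[p]) + x.a = 1) ∧
      -- Rmk 5.3.1, first sentence: ALL verticial and edge-like subgroups are compact and arithmetically ample
      VerticialEdgeLikeCompactAmpleStatement D aug ∧
      -- NON-SPLIT: `Π_A` acts faithfully on the (non-trivial) geometric vertex group `Π_v ∩ Ker(aug)`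
      (∀ g ∈ D.vertGp (), (∀ k ∈ D.vertGp () ⊓ aug.ker, g * k = k * g) → aug g = 1) ∧
      D.vertGp () ⊓ aug.ker ≠ ⊥ ∧
      ¬ IsOpen ((⊥ : Subgroup ℤ_[p]ˣ) : Set ℤ_[p]ˣ) ∧
      -- Thm 5.4's hypotheses: `hbot` and `hest`
      ¬ IsArithAmple aug (⊥ : Subgroup (PadicAffine p)) ∧
      IsTotallyArithEstranged D aug := by
  classical
  -- the augmentation: the linear part
  let aug : PadicAffine p →* ℤ_[p]ˣ := MonoidHom.mk' (fun x => x.u) PadicAffine.mul_u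
  have haug : ∀ x, aug x = x.u := fun _ => rfl
  -- `𝔪 = pℤ_p` and the facts about it that we use
  have norm_p_lt : ‖(p : ℤ_[p])‖ < 1 := by
    rw [PadicInt.norm_p]
    exact inv_lt_one_of_one_lt₀ (by exact_mod_cast (Fact.out : p.Prime).one_lt)
  have p_ne : (p : ℤ_[p]) ≠ 0 := PadicInt.irreducible_p.ne_zero
  have lt_one_add : ∀ {a b : ℤ_[p]}, ‖a‖ < 1 → ‖b‖ < 1 → ‖a + b‖ < 1 := fun ha hb =>
    (PadicInt.nonarchimedean _ _).trans_lt (max_lt ha hb)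
  have lt_one_mul : ∀ (v : ℤ_[p]) {a : ℤ_[p]}, ‖a‖ < 1 → ‖v * a‖ < 1 := fun v a ha => by
    rw [norm_mul]
    exact (mul_le_of_le_one_left (norm_nonneg _) (PadicInt.norm_le_one v)).trans_lt ha
  have unit_add_ne_zero : ∀ (u : ℤ_[p]ˣ) {n : ℤ_[p]}, ‖n‖ < 1 → (u : ℤ_[p]) + n ≠ 0 := by
    intro u n hn h0
    have hn' : n = -(u : ℤ_[p]) := by linear_combination h0
    rw [hn', norm_neg, PadicInt.isUnit_iff.mp u.isUnit] at hn
    exact lt_irrefl _ hn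
  -- the three decomposition groups
  let A : Subgroup (PadicAffine p) :=
    { carrier := {x | ‖x.a‖ < 1}
      mul_mem' := fun {x y} hx hy => by
        simp only [Set.mem_setOf_eq, PadicAffine.mul_a] at hx hy ⊢
        exact lt_one_add hx (lt_one_mul _ hy)
      one_mem' := by simp only [Set.mem_setOf_eq, PadicAffine.one_a, norm_zero, zero_lt_one]
      inv_mem' := fun {x} hx => by
        simp only [Set.mem_setOf_eq, PadicAffine.inv_a, norm_neg] at hx ⊢
        exact lt_one_mul _ hx }
  have memA : ∀ x, x ∈ A ↔ ‖x.a‖ < 1 := fun _ => Iff.rfl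
  let B₀ : Subgroup (PadicAffine p) :=
    { carrier := {x | x.a = 0}
      mul_mem' := fun {x y} hx hy => by
        simp only [Set.mem_setOf_eq, PadicAffine.mul_a] at hx hy ⊢
        rw [hx, hy, mul_zero, add_zero]
      one_mem' := PadicAffine.one_a
      inv_mem' := fun {x} hx => by
        simp only [Set.mem_setOf_eq, PadicAffine.inv_a] at hx ⊢
        rw [hx, mul_zero, neg_zero] }
  have memB₀ : ∀ x, x ∈ B₀ ↔ x.a = 0 := fun _ => Iff.rfl
  let B₁ : Subgroup (PadicAffine p) :=
    { carrier := {x | ‖x.a‖ < 1 ∧ (x.u : ℤ_[p]) + x.a = 1}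
      mul_mem' := fun {x y} hx hy => by
        simp only [Set.mem_setOf_eq, PadicAffine.mul_a, PadicAffine.mul_u, Units.val_mul] at hx hy ⊢
        refine ⟨lt_one_add hx.1 (lt_one_mul _ hy.1), ?_⟩
        linear_combination hx.2 + (x.u : ℤ_[p]) * hy.2
      one_mem' := by
        simp only [Set.mem_setOf_eq, PadicAffine.one_a, PadicAffine.one_u, norm_zero, zero_lt_one, Units.val_one,
          add_zero, and_self]
      inv_mem' := fun {x} hx => by
        simp only [Set.mem_setOf_eq, PadicAffine.inv_a, PadicAffine.inv_u, norm_neg] at hx ⊢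
        refine ⟨lt_one_mul _ hx.1, ?_⟩
        have hu : (x.u : ℤ_[p]) * ((x.u⁻¹ : ℤ_[p]ˣ) : ℤ_[p]) = 1 := Units.mul_inv x.u
        linear_combination (-((x.u⁻¹ : ℤ_[p]ˣ) : ℤ_[p])) * hx.2 + hu }
  have memB₁ : ∀ x, x ∈ B₁ ↔ ‖x.a‖ < 1 ∧ (x.u : ℤ_[p]) + x.a = 1 := fun _ => Iff.rfl
  -- fixed points: `B₀ = Stab(0)`, `B₁ ⊆ Stab(1)`
  have fix₀ : ∀ k ∈ B₀, (k.u : ℤ_[p]) * 0 + k.a = 0 := fun k hk => by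
    rw [(memB₀ k).mp hk, mul_zero, add_zero]
  have fix₁ : ∀ k ∈ B₁, (k.u : ℤ_[p]) * 1 + k.a = 1 := fun k hk => by
    rw [mul_one]
    exact ((memB₁ k).mp hk).2
  -- inclusions
  have hB₀A : B₀ ≤ A := fun x hx => by
    rw [memA, (memB₀ x).mp hx, norm_zero]
    exact zero_lt_one
  have hB₁A : B₁ ≤ A := fun x hx => ((memB₁ x).mp hx).1
  -- the datum on the loop semi-graph
  let D : DecompositionData (PadicAffine p) Unit Bool :=
    { E := Unit
      edgeOf := fun _ => ()
      abut := fun _ => some ()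
      vertGp := fun _ => A
      brGp := fun b => bif b then B₁ else B₀
      brGp_le_vertGp := by
        rintro (_ | _) v _
        · exact hB₀A
        · exact hB₁A }
  have brGp_false : D.brGp false = B₀ := rfl
  have brGp_true : D.brGp true = B₁ := rfl
  have vertGp_eq : ∀ v, D.vertGp v = A := fun _ => rfl
  -- the key trivial-intersection lemma: `Stab(c) ∩ g Stab(c') g⁻¹ = 1` whenever `c ≠ g · c'`
  have key : ∀ (K K' : Subgroup (PadicAffine p)) (c c' : ℤ_[p]) (g : PadicAffine p),
      (∀ k ∈ K, (k.u : ℤ_[p]) * c + k.a = c) → (∀ k ∈ K', (k.u : ℤ_[p]) * c' + k.a = c') →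
      c ≠ (g.u : ℤ_[p]) * c' + g.a → ∀ h ∈ K ⊓ conjSubgroup g K', h = 1 := by
    intro K K' c c' g hK hK' hne h hh
    rw [Subgroup.mem_inf] at hh
    obtain ⟨hhK, hhc⟩ := hh
    obtain ⟨k, hk, rfl⟩ := Subgroup.mem_map.mp hhc
    rw [MulEquiv.coe_toMonoidHom, MulAut.conj_apply] at hhK ⊢
    exact affine_eq_one_of_fix_two (hK _ hhK) (affine_conj_fix g k (hK' k hk)) hne
  -- ampleness of the three representatives
  have ampleA : IsArithAmple aug A := by
    have htop : (A.map aug : Set ℤ_[p]ˣ) = Set.univ := by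
      ext u
      simp only [Set.mem_univ, iff_true, SetLike.mem_coe, Subgroup.mem_map]
      exact ⟨⟨0, u⟩, by rw [memA, norm_zero]; exact zero_lt_one, rfl⟩
    unfold IsArithAmple
    rw [htop]
    exact isOpen_univ
  have ampleB₀ : IsArithAmple aug B₀ := by
    have htop : (B₀.map aug : Set ℤ_[p]ˣ) = Set.univ := by
      ext u
      simp only [Set.mem_univ, iff_true, SetLike.mem_coe, Subgroup.mem_map]
      exact ⟨⟨0, u⟩, rfl, rfl⟩
    unfold IsArithAmple
    rw [htop]
    exact isOpen_univ
  have ampleB₁ : IsArithAmple aug B₁ := by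
    have hball : (B₁.map aug : Set ℤ_[p]ˣ) = Units.val ⁻¹' Metric.ball (1 : ℤ_[p]) 1 := by
      ext u
      simp only [SetLike.mem_coe, Subgroup.mem_map, Set.mem_preimage, Metric.mem_ball, dist_eq_norm]
      constructor
      · rintro ⟨g, hg, rfl⟩
        obtain ⟨hn, hsum⟩ := (memB₁ g).mp hg
        have : ((aug g : ℤ_[p]ˣ) : ℤ_[p]) - 1 = -g.a := by rw [haug]; linear_combination hsum
        rw [this, norm_neg]
        exact hn
      · intro hu
        refine ⟨⟨1 - (u : ℤ_[p]), u⟩, (memB₁ _).mpr ⟨?_, ?_⟩, rfl⟩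
        · rw [← norm_neg, neg_sub]
          exact hu
        · ring
    unfold IsArithAmple
    rw [hball]
    exact Metric.isOpen_ball.preimage Units.continuous_val
  -- compactness of the three representatives (closed subgroups of the compact group `Aff(ℤ_p)`)
  have hAset : (A : Set (PadicAffine p)) = (fun x : PadicAffine p => x.a) ⁻¹' Metric.ball (0 : ℤ_[p]) 1 := by
    ext x
    simp only [SetLike.mem_coe, memA, Set.mem_preimage, Metric.mem_ball, dist_zero_right]
  have cptA : IsCompact (A : Set (PadicAffine p)) := by
    refine IsClosed.isCompact ?_
    rw [hAset]
    exact (IsUltrametricDist.isClosed_ball (0 : ℤ_[p]) 1).preimage PadicAffine.continuous_a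
  have cptB₀ : IsCompact (B₀ : Set (PadicAffine p)) := by
    refine IsClosed.isCompact ?_
    have : (B₀ : Set (PadicAffine p)) = (fun x : PadicAffine p => x.a) ⁻¹' {0} := rfl
    rw [this]
    exact isClosed_singleton.preimage PadicAffine.continuous_a
  have cptB₁ : IsCompact (B₁ : Set (PadicAffine p)) := by
    refine IsClosed.isCompact ?_
    have : (B₁ : Set (PadicAffine p)) =
        (fun x : PadicAffine p => x.a) ⁻¹' Metric.ball (0 : ℤ_[p]) 1 ∩
          (fun x : PadicAffine p => (x.u : ℤ_[p]) + x.a) ⁻¹' {1} := by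
      ext x
      simp only [SetLike.mem_coe, memB₁, Set.mem_inter_iff, Set.mem_preimage, Metric.mem_ball, dist_zero_right,
        Set.mem_singleton_iff]
    rw [this]
    exact ((IsUltrametricDist.isClosed_ball (0 : ℤ_[p]) 1).preimage PadicAffine.continuous_a).inter
      (isClosed_singleton.preimage (PadicAffine.continuous_uval.add PadicAffine.continuous_a))
  -- total arithmetic estrangement
  have hest : IsTotallyArithEstranged D aug := by
    intro e b _ v _ g hg
    rw [vertGp_eq] at hg
    have hn : ‖g.a‖ < 1 := (memA g).mp hg
    refine ⟨?_, ?_⟩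
    · -- (i) the other branch `b' ≠ b`
      intro b' _ hb'
      cases b <;> cases b'
      · exact absurd rfl hb'
      · -- `b = b₀ = Stab 0`, `b' = b₁ ⊆ Stab 1`: `g · 1 = u + a ∈ ℤ_pˣ`, `≠ 0`
        rw [brGp_false, brGp_true]
        refine not_isArithAmple_of_forall_eq_one _ (key B₀ B₁ 0 1 g fix₀ fix₁ ?_)
        rw [mul_one]
        exact (unit_add_ne_zero g.u hn).symm
      · -- `b = b₁ ⊆ Stab 1`, `b' = b₀ = Stab 0`: `g · 0 = a ∈ pℤ_p`, `≠ 1`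
        rw [brGp_false, brGp_true]
        refine not_isArithAmple_of_forall_eq_one _ (key B₁ B₀ 1 0 g fix₁ fix₀ ?_)
        rw [mul_zero, zero_add]
        intro h1
        rw [← h1, norm_one] at hn
        exact lt_irrefl _ hn
      · exact absurd rfl hb'
    · -- (ii) the same branch, `g ∉ Π_b`
      intro hgb
      cases b
      · -- `Stab 0`, `g · 0 = a ≠ 0`
        rw [brGp_false] at hgb ⊢
        refine not_isArithAmple_of_forall_eq_one _ (key B₀ B₀ 0 0 g fix₀ fix₀ ?_)
        rw [mul_zero, zero_add]
        exact fun h0 => hgb ((memB₀ g).mpr h0.symm)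
      · -- `Stab 1 ∩ Π_v`, `g · 1 = u + a ≠ 1`
        rw [brGp_true] at hgb ⊢
        refine not_isArithAmple_of_forall_eq_one _ (key B₁ B₁ 1 1 g fix₁ fix₁ ?_)
        rw [mul_one]
        exact fun h1 => hgb ((memB₁ g).mpr ⟨hn, h1.symm⟩)
  -- the geometric vertex group contains the translation `(p, 1) ≠ 1`
  have hk : (⟨(p : ℤ_[p]), 1⟩ : PadicAffine p) ∈ A ⊓ aug.ker := by
    refine Subgroup.mem_inf.mpr ⟨?_, ?_⟩
    · rw [memA]
      exact norm_p_lt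
    · rw [MonoidHom.mem_ker, haug]
  refine ⟨aug, D, haug, ?_, fun u => ⟨⟨0, u⟩, rfl⟩, fun _ _ => rfl, fun _ => rfl, memA, memB₀, memB₁, ?_, ?_,
    ?_, not_isOpen_bot_units_padicInt p, ?_, hest⟩
  · -- continuity of the linear part into `ℤ_pˣ`
    rw [Units.continuous_iff]
    exact ⟨PadicAffine.continuous_uval, PadicAffine.continuous_uinv⟩
  · -- Rmk 5.3.1 (first sentence) for ALL verticial / edge-like subgroups, from the representatives
    refine verticialEdgeLikeCompactAmple_of_representatives D aug (fun _ => cptA) (fun _ => ampleA) ?_ ?_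
    · rintro (_ | _)
      · exact cptB₀
      · exact cptB₁
    · rintro (_ | _)
      · exact ampleB₀
      · exact ampleB₁
  · -- non-split: `Π_A` acts faithfully on the geometric vertex group (by multiplication on `pℤ_p`)
    intro g _ hcomm
    have h := congrArg PadicAffine.a (hcomm _ hk)
    simp only [PadicAffine.mul_a, Units.val_one, one_mul] at h
    have hu : ((g.u : ℤ_[p]) - 1) * (p : ℤ_[p]) = 0 := by linear_combination h
    rcases mul_eq_zero.mp hu with h1 | h1
    · rw [haug]
      exact Units.ext (by rw [sub_eq_zero.mp h1, Units.val_one])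
    · exact absurd h1 p_ne
  · -- the geometric vertex group is non-trivial
    intro hbot
    rw [vertGp_eq] at hbot
    have hk' := hk
    rw [hbot, Subgroup.mem_bot] at hk'
    exact p_ne (by simpa using congrArg PadicAffine.a hk')
  · -- `hbot`: from `hest`, by abc-iut's `IsTotallyArithEstranged.not_isArithAmple_bot` (two branches at `v`)
    exact hest.not_isArithAmple_bot true () rfl (Or.inr ⟨false, rfl, Bool.false_ne_true⟩)

end Literature.AnabelianGeometry.SemiGraphs

end
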